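import Summits.RiemannHypothesis.RiemannHypothesis.Theses.LiTailLaguerre
import Summits.RiemannHypothesis.RiemannHypothesis.Theorems.LiTailLaguerreDefs
import Summits.RiemannHypothesis.RiemannHypothesis.Theorems.LiTailLaguerreGammaTailWeights
import Literature.NumberTheory.LFunctions.RiemannXiLogDeriv
import Literature.NumberTheory.LFunctions.ExplicitFormulaPsiProofs
import Literature.NumberTheory.LFunctions.WeilZeroSum
import HarnessLib

/-!
# RiemannHypothesis / LiTailLaguerre — crux K4′ `LiTailHorizontal`: the bottom edge of the half-strip at a GOOD height (RH-FREE)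

RH-FREE [tail-p2; binder K4′ of route `Theses/LiTailLaguerre.lean`, rung «Li TAIL–LAGUERRE LAW» L-P(P1-tail), cell
`pub/rh-li`, dossier `theory/route/r7`], item `LiTailHorizontal` (stmt-RiemannHypothesis-19705): for every `c > 0` there
are `N`, `C` such that for `n ≥ N` and every `T ∈ [c√n, n]` there is a GOOD height `T' ∈ [T, T + 1]` — no zero of `ξ` on
the segment `[−1/2, 3/2] × {T'}` — with

  `|liHorizTail n T'| ≤ C log² n`,   `liHorizTail n T' = (1/π) Im ∫_{−1/2}^{3/2} ξ'/ξ(x + iT') (1 − F_n(x + iT')) dx`.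

Proof (a near-copy of the PROVED window version `Theorems/LiPrimeEchoHorizontalEdges.lean`, with the CO-WEIGHT `1 − F_n`
and the longer range `T ≤ n`): (1) Montgomery–Vaughan Lemma 12.2 good heights (`ExplicitPsi.exists_goodHeight_all`:
`T' ∈ [T, T+1]`, `η ∈ (0, 1]`, `1/η ≤ 2 + log(T'+2)/c₀`, every non-trivial zero at distance `≥ η` from `T'`) with the
bookkeeping `log(T' + 4)/η ≤ 2(2 + 2/c₀) log² n` for `0 ≤ T ≤ n`, `n ≥ 3` (`T' + 4 ≤ n + 5 ≤ n²`); (2) the segment bound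
`|ξ'/ξ(σ + iT')| ≤ C₀ log(|T'| + 4)/η` on `σ ∈ [−1/2, 3/2]` (`exists_norm_logDeriv_riemannXi_le`, Bombieri §2); (3) the
co-weight bound `|1 − F_n(σ + iT')| ≤ 1 + e^{n/T'²} ≤ 1 + e^{1/c²}` for `σ ≥ −1/2`, `T' ≥ c√n`
(`|1 − 1/s|² ≤ 1 + 2/T'²`; the strip bound `GammaTail.norm_liWeight_le_exp_div` of the landed K3′ weights file);
segment length `2`, via `intervalIntegral.norm_integral_le_of_norm_le_const` (no integrability is needed); and no zero
of `ξ` on the segment since a zero of `ξ` is a non-trivial zero of `ζ` (`riemannXi_zero_prop`).  The registered birth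
skeleton's split `liHorizTail = liHorizTerm 0 − liHorizTerm n` is not needed: the co-weight is bounded directly.  Nothing
about the position of the zeros is used; nothing here bears on the truth of RH.
-/

noncomputable section

-- D-0017: `Summit.<S>.<S>.…` is the designed namespace of a single-problem summit.
set_option linter.dupNamespace false

open Complex MeasureTheory intervalIntegral Set
open scoped Interval

namespace Summit.RiemannHypothesis.RiemannHypothesis.Theorems.LiTheory

open Literature.NumberTheory.LFunctions

namespace TailHorizontal

/-- The CO-WEIGHT on a horizontal segment: `|1 − F_n(x + iT)| ≤ 1 + e^{n/T²}` for `x ≥ −1/2`, `T > 0`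
(from the landed strip bound `GammaTail.norm_liWeight_le_exp_div`: `|1 − 1/s|² ≤ 1 + 2/T² ≤ e^{2/T²}`). -/
theorem norm_one_sub_liWeight_le_exp_div (n : ℕ) {x T : ℝ} (hx : -(1 / 2 : ℝ) ≤ x) (hT : 0 < T) :
    ‖1 - liWeight n (x + T * I)‖ ≤ 1 + Real.exp (n / T ^ 2) := by
  refine (norm_sub_le _ _).trans ?_
  rw [norm_one]
  exact add_le_add le_rfl (GammaTail.norm_liWeight_le_exp_div n hx hT)

/-- **Segment bound at a separated height (co-weight).**  There is `C ≥ 0` such that for `T ≥ 2` and `0 < η ≤ 1` with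
every zero `ρ` of `ζ` with `Re ρ > 0` at distance `≥ η` from the ordinate `T`: `T ∈ liGoodHeights` and
`|liHorizTail n T| ≤ C log(|T| + 4)/η · (1 + e^{n/T²})`. -/
theorem horizTail_pointwise :
    ∃ C : ℝ, 0 ≤ C ∧ ∀ (n : ℕ) (T η : ℝ), 2 ≤ T → 0 < η → η ≤ 1 →
      (∀ ρ : ℂ, riemannZeta ρ = 0 → 0 < ρ.re → η ≤ |ρ.im - T|) →
        T ∈ liGoodHeights ∧
          |liHorizTail n T| ≤ C * Real.log (|T| + 4) / η * (1 + Real.exp (n / T ^ 2)) := by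
  obtain ⟨C, hC, hseg⟩ := exists_norm_logDeriv_riemannXi_le
  refine ⟨C, hC.le, fun n T η hT2 hη0 hη1 hZ ↦ ?_⟩
  have hT0 : 0 < T := by linarith
  have hTabs : 2 ≤ |T| := by rw [abs_of_pos hT0]; exact hT2
  have hseg' := hseg T η hTabs hη0 hη1 hZ
  have hlog0 : 0 ≤ Real.log (|T| + 4) := Real.log_nonneg (by linarith [abs_nonneg T])
  constructor
  · -- no zero of `ξ` on the segment
    intro x _ h0
    obtain ⟨hζ, hre, -, -⟩ := riemannXi_zero_prop h0
    have hre' : 0 < (x + T * I : ℂ).re := hre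
    have h := hZ _ hζ hre'
    simp at h
    linarith
  · -- the segment integral
    set B : ℝ := 1 + Real.exp (n / T ^ 2) with hB
    have hB0 : 0 ≤ B := by positivity
    have hK : 0 ≤ C * Real.log (|T| + 4) / η := by positivity
    have hpt : ∀ x ∈ Ι (-(1 / 2 : ℝ)) (3 / 2),
        ‖logDeriv riemannXi (x + T * I) * (1 - liWeight n (x + T * I))‖ ≤ C * Real.log (|T| + 4) / η * B := by
      intro x hx
      rw [uIoc_of_le (by norm_num)] at hx
      rw [norm_mul]
      exact mul_le_mul (hseg' x ⟨hx.1.le, hx.2⟩) (norm_one_sub_liWeight_le_exp_div n hx.1.le hT0)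
        (norm_nonneg _) hK
    have hI := intervalIntegral.norm_integral_le_of_norm_le_const hpt
    have hlen : |(3 / 2 : ℝ) - -(1 / 2)| = 2 := by norm_num
    rw [hlen] at hI
    unfold liHorizTail
    rw [abs_mul, abs_of_pos (by positivity : (0 : ℝ) < 1 / Real.pi)]
    have him := Complex.abs_im_le_norm
      (∫ x in (-(1 / 2 : ℝ))..(3 / 2 : ℝ), logDeriv riemannXi (x + T * I) * (1 - liWeight n (x + T * I)))
    have hπ : 1 / Real.pi ≤ 1 / 2 :=
      one_div_le_one_div_of_le (by norm_num) (by linarith [Real.pi_gt_three])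
    calc 1 / Real.pi * |(∫ x in (-(1 / 2 : ℝ))..(3 / 2 : ℝ),
            logDeriv riemannXi (x + T * I) * (1 - liWeight n (x + T * I))).im|
        ≤ 1 / 2 * (C * Real.log (|T| + 4) / η * B * 2) :=
          mul_le_mul hπ (him.trans hI) (abs_nonneg _) (by norm_num)
      _ = C * Real.log (|T| + 4) / η * B := by ring

/-- **Good heights with the log bookkeeping on `[0, n]`.**  There are `N`, `A ≥ 0` such that for `n ≥ N` and
`0 ≤ T ≤ n` some `T' ∈ [T, T+1]` and `η ∈ (0, 1]` satisfy `log(|T'| + 4)/η ≤ A log² n` and separate `T'` by `η` from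
the ordinate of every zero of `ζ` with positive real part (Montgomery–Vaughan Lemma 12.2,
`ExplicitPsi.exists_goodHeight_all`). -/
theorem goodHeight_log_tail :
    ∃ N : ℕ, ∃ A : ℝ, 0 ≤ A ∧ ∀ n : ℕ, N ≤ n → ∀ T : ℝ, 0 ≤ T → T ≤ n →
      ∃ T' η : ℝ, T ≤ T' ∧ T' ≤ T + 1 ∧ 0 < η ∧ η ≤ 1 ∧ Real.log (|T'| + 4) / η ≤ A * Real.log n ^ 2 ∧
        ∀ ρ : ℂ, riemannZeta ρ = 0 → 0 < ρ.re → η ≤ |ρ.im - T'| := by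
  obtain ⟨c₀, hc₀, hgh⟩ := ExplicitPsi.exists_goodHeight_all
  refine ⟨3, 2 * (2 + 2 / c₀), by positivity, fun n hn T hT0 hTn ↦ ?_⟩
  obtain ⟨T₁, hT₁l, hT₁u, η, hη0, hη1, hinv, hsep⟩ := hgh T hT0
  refine ⟨T₁, η, hT₁l, hT₁u, hη0, hη1, ?_, fun ρ hζ hre ↦
    (hsep ρ (ZetaZeros.riemannZetaNontrivialZeros.mem_of_re_pos hζ hre)).1⟩
  have hn3 : (3 : ℝ) ≤ n := by exact_mod_cast hn
  have hT₁0 : 0 ≤ T₁ := hT0.trans hT₁l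
  have hT₁n : T₁ ≤ n + 1 := by linarith
  -- `n + 5 ≤ n²` for `n ≥ 3`
  have hsq : (n : ℝ) + 5 ≤ (n : ℝ) ^ 2 := by nlinarith
  have hn0 : (0 : ℝ) < n := by linarith
  have hlogn1 : 1 ≤ Real.log n := by
    rw [Real.le_log_iff_exp_le hn0]
    have := Real.exp_one_lt_d9; linarith
  have hlog2 : Real.log ((n : ℝ) ^ 2) = 2 * Real.log n := by
    rw [Real.log_pow]; push_cast; ring
  have hl4 : Real.log (|T₁| + 4) ≤ 2 * Real.log n := by
    rw [abs_of_nonneg hT₁0, ← hlog2]; exact Real.log_le_log (by linarith) (by linarith)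
  have hl2 : Real.log (T₁ + 2) ≤ 2 * Real.log n := by
    rw [← hlog2]; exact Real.log_le_log (by linarith) (by linarith)
  have hl40 : 0 ≤ Real.log (|T₁| + 4) := Real.log_nonneg (by linarith [abs_nonneg T₁])
  -- `1/η ≤ (2 + 2/c₀) log n`
  have hinv' : 1 / η ≤ (2 + 2 / c₀) * Real.log n := by
    have h1 : Real.log (T₁ + 2) / c₀ ≤ 2 * Real.log n / c₀ :=
      div_le_div_of_nonneg_right hl2 hc₀.le
    calc 1 / η ≤ 2 + Real.log (T₁ + 2) / c₀ := hinv
      _ ≤ 2 * Real.log n + 2 * Real.log n / c₀ := by linarith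
      _ = (2 + 2 / c₀) * Real.log n := by ring
  calc Real.log (|T₁| + 4) / η = Real.log (|T₁| + 4) * (1 / η) := by ring
    _ ≤ (2 * Real.log n) * ((2 + 2 / c₀) * Real.log n) :=
        mul_le_mul hl4 hinv' (by positivity) (by positivity)
    _ = 2 * (2 + 2 / c₀) * Real.log n ^ 2 := by ring

end TailHorizontal

open TailHorizontal in
/-- **Crux K4′ `LiTailHorizontal` of route `LiTailLaguerre`** (stmt-RiemannHypothesis-19705; RH-FREE): for `c > 0` there
are `N`, `C` with: for `n ≥ N` and `T ∈ [c√n, n]` some good height `T' ∈ [T, T+1]` has `|liHorizTail n T'| ≤ C log² n`.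
Verbatim the route statement. -/
theorem liTailHorizontal_bound :
    ∀ c : ℝ, 0 < c → ∃ N : ℕ, ∃ C : ℝ, ∀ n : ℕ, N ≤ n → ∀ T : ℝ, c * Real.sqrt n ≤ T → T ≤ n →
      ∃ T' : ℝ, T ≤ T' ∧ T' ≤ T + 1 ∧ T' ∈ liGoodHeights ∧ |liHorizTail n T'| ≤ C * Real.log n ^ 2 := by
  intro c hc
  obtain ⟨N, A, hA0, hN⟩ := goodHeight_log_tail
  obtain ⟨C, hC0, hP⟩ := horizTail_pointwise
  refine ⟨max N ⌈4 / c ^ 2⌉₊, C * A * (1 + Real.exp (1 / c ^ 2)), fun n hn T hT1 hT2 ↦ ?_⟩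
  have hnN : N ≤ n := le_trans (le_max_left _ _) hn
  have hn4 : 4 / c ^ 2 ≤ (n : ℝ) :=
    (Nat.le_ceil _).trans (by exact_mod_cast le_trans (le_max_right _ _) hn)
  have hn0 : (0 : ℝ) ≤ n := by positivity
  -- `c√n ≥ 2`
  have hcs : 2 ≤ c * Real.sqrt n := by
    have h4 : (2 / c) ^ 2 ≤ (n : ℝ) := by
      calc (2 / c) ^ 2 = 4 / c ^ 2 := by ring
        _ ≤ (n : ℝ) := hn4
    have h2c : 2 / c ≤ Real.sqrt n := by
      rw [← Real.sqrt_sq (by positivity : (0 : ℝ) ≤ 2 / c)]; exact Real.sqrt_le_sqrt h4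
    have := mul_le_mul_of_nonneg_left h2c hc.le
    rwa [mul_div_cancel₀ _ hc.ne'] at this
  have hT0 : 0 ≤ T := by linarith
  obtain ⟨T', η, hTT', hT'1, hη0, hη1, hlog, hsep⟩ := hN n hnN T hT0 hT2
  have hT'2 : 2 ≤ T' := by linarith
  obtain ⟨hgood, hbd⟩ := hP n T' η hT'2 hη0 hη1 hsep
  refine ⟨T', hTT', hT'1, hgood, hbd.trans ?_⟩
  -- `e^{n/T'²} ≤ e^{1/c²}` since `c² n ≤ (c√n)² ≤ T'²`
  have hT'pos : 0 < T' := by linarith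
  have hcsq : c ^ 2 * n ≤ T' ^ 2 := by
    have h1 : (c * Real.sqrt n) ^ 2 = c ^ 2 * n := by rw [mul_pow, Real.sq_sqrt hn0]
    rw [← h1]
    exact pow_le_pow_left₀ (by linarith) (by linarith) 2
  have hexp : Real.exp (n / T' ^ 2) ≤ Real.exp (1 / c ^ 2) := by
    rw [Real.exp_le_exp, div_le_div_iff₀ (by positivity) (by positivity)]
    linarith
  have hlog0 : 0 ≤ Real.log (|T'| + 4) := Real.log_nonneg (by linarith [abs_nonneg T'])
  calc C * Real.log (|T'| + 4) / η * (1 + Real.exp (n / T' ^ 2))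
      = C * (Real.log (|T'| + 4) / η) * (1 + Real.exp (n / T' ^ 2)) := by ring
    _ ≤ C * (A * Real.log n ^ 2) * (1 + Real.exp (1 / c ^ 2)) :=
        mul_le_mul (mul_le_mul_of_nonneg_left hlog hC0) (by linarith) (by positivity) (by positivity)
    _ = C * A * (1 + Real.exp (1 / c ^ 2)) * Real.log n ^ 2 := by ring

/-- **Item `LiTailHorizontal` of route `LiTailLaguerre`** (stmt-RiemannHypothesis-19705; RH-FREE), closed BY NAME. -/
theorem liTailHorizontal_proof :
    Summit.RiemannHypothesis.RiemannHypothesis.Theses.LiTailLaguerre.LiTailHorizontal :=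
  liTailHorizontal_bound

end Summit.RiemannHypothesis.RiemannHypothesis.Theorems.LiTheory

end
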